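import Summits.RiemannHypothesis.RiemannHypothesis.Theorems.ScrewManifestCertDual8

/-!
# ScrewManifestCertWaveChecker — part of the integer-screw manifest-certificate development

Batch 3F, second part: the interval checker (`QEncl`, `DEncl`, `DDEncl`, `cellOK`, `runCells`,
`runZero`) and its soundness lemmas up to cell inflation (`mem_inflCS`).
(Split of `ScrewManifestCert.lean` v1.5 for the Theorems line cap; overview and file layout in
`Summits.RiemannHypothesis.RiemannHypothesis.Theorems.ScrewManifestCertDefs`.
Nothing in this file bears on the truth of RH.)
-/

set_option linter.dupNamespace false
set_option autoImplicit false

namespace Summit.RiemannHypothesis.RiemannHypothesis.Theorems.IntegerScrew.Manifest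

open Literature.NumberTheory.LFunctions Matrix

section Batch3F

open Literature.Analysis.ValidatedNumerics Literature.Analysis.ValidatedNumerics.Numerics Finset

/-! ### The interval checker -/

/-- Enclosure of `x_i`. -/
def X8 (logs : List FI) (i : ℕ) : FI := RungCert.lg logs (i + 2)

/-- Trivial `cos/sin` enclosure (junk for out-of-range lookups). -/
def trivCS : FI × FI := (⟨-(SC : ℤ), SC⟩, ⟨-(SC : ℤ), SC⟩)

/-- The seven `(cos, sin)(t x_i)` enclosures for `t ∈ T`. -/
def csList (logs : List FI) (T : FI) : List (FI × FI) :=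
  (List.range 7).map fun i => FI.cosSin (T.mul (X8 logs i))

/-- Lookup of the `i`-th `(cos, sin)` enclosure pair (junk `trivCS` out of range). -/
def csAt (L : List (FI × FI)) (i : ℕ) : FI × FI := L.getD i trivCS

/-- Interval sum `Σ_{k<n} f k`. -/
def sumEncl (f : ℕ → FI) : ℕ → FI
  | 0 => FI.ofInt 0
  | n + 1 => (sumEncl f n).add (f n)

/-- The point `n/1024` and the cell `[n/1024, (n+w)/1024]` as intervals (scale `2^48 = 1024·2^38`). -/
def ptFI (n : ℕ) : FI := ⟨(n : ℤ) * 2 ^ 38, (n : ℤ) * 2 ^ 38⟩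
/-- The cell `[n/1024, (n+w)/1024]` as an interval (scale `2^48`). -/
def cellFI (n w : ℕ) : FI := ⟨(n : ℤ) * 2 ^ 38, ((n + w : ℕ) : ℤ) * 2 ^ 38⟩

/-- Row sums `r_i = Σ_j (2^41 Y)_ij` and the total `Σ_ij (2^41 Y)_ij`. -/
def rz (i : ℕ) : ℤ := yz i 0 + yz i 1 + yz i 2 + yz i 3 + yz i 4 + yz i 5 + yz i 6
/-- The total `Σ_ij (2^41 Y)_ij`. -/
def yTot : ℤ := rz 0 + rz 1 + rz 2 + rz 3 + rz 4 + rz 5 + rz 6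

/-- Interval matrix–vector product `(Y v)_i = Σ_j v_j (2^41 Y)_ij` (exact integer weights). -/
def mvY (v : ℕ → FI) (i : ℕ) : FI := sumEncl (fun j => (v j).mulInt (yz i j)) 7

/-- BILINEAR evaluation of `Q = Σy − 2 Σ_i r_i c_i + cᵀ(Yc) + sᵀ(Ys)` (14 interval products). -/
def QEnclL (L : List (FI × FI)) : FI :=
  (((FI.ofInt yTot).sub ((sumEncl (fun i => (csAt L i).1.mulInt (rz i)) 7).mulInt 2)).add
    (sumEncl (fun i => (csAt L i).1.mul (mvY (fun j => (csAt L j).1) i)) 7)).add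
    (sumEncl (fun i => (csAt L i).2.mul (mvY (fun j => (csAt L j).2) i)) 7)

/-- BILINEAR evaluation of `Q′ = 2 (Σ_i r_i x_i s_i − (xs)ᵀ(Yc) + (xc)ᵀ(Ys))` (uses `Y = Yᵀ`). -/
def DEnclL (logs : List FI) (L : List (FI × FI)) : FI :=
  (((sumEncl (fun i => ((X8 logs i).mul (csAt L i).2).mulInt (rz i)) 7).sub
    (sumEncl (fun i => ((X8 logs i).mul (csAt L i).2).mul (mvY (fun j => (csAt L j).1) i)) 7)).add
    (sumEncl (fun i => ((X8 logs i).mul (csAt L i).1).mul (mvY (fun j => (csAt L j).2) i)) 7)).mulInt 2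

/-- BILINEAR evaluation of `Q″ = 2 (Σ_i r_i x_i² c_i − (x²c)ᵀ(Yc) − (x²s)ᵀ(Ys) + (xc)ᵀ(Y xc) + (xs)ᵀ(Y xs))`. -/
def DDEnclL (logs : List FI) (L : List (FI × FI)) : FI :=
  (((((sumEncl (fun i => (((X8 logs i).mul (X8 logs i)).mul (csAt L i).1).mulInt (rz i)) 7).sub
    (sumEncl (fun i => (((X8 logs i).mul (X8 logs i)).mul (csAt L i).1).mul
      (mvY (fun j => (csAt L j).1) i)) 7)).sub
    (sumEncl (fun i => (((X8 logs i).mul (X8 logs i)).mul (csAt L i).2).mul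
      (mvY (fun j => (csAt L j).2) i)) 7)).add
    (sumEncl (fun i => ((X8 logs i).mul (csAt L i).1).mul
      (mvY (fun j => (X8 logs j).mul (csAt L j).1) i)) 7)).add
    (sumEncl (fun i => ((X8 logs i).mul (csAt L i).2).mul
      (mvY (fun j => (X8 logs j).mul (csAt L j).2) i)) 7)).mulInt 2

/-- Enclosure of `Q` over `t ∈ T`. -/
def QEncl (logs : List FI) (T : FI) : FI := QEnclL (csList logs T)
/-- Enclosure of `Q′` over `t ∈ T`. -/
def DEncl (logs : List FI) (T : FI) : FI := DEnclL logs (csList logs T)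
/-- Enclosure of `Q″` over `t ∈ T`. -/
def DDEncl (logs : List FI) (T : FI) : FI := DDEnclL logs (csList logs T)

/-- `⌈1024·log(i+2)⌉`, checked against the log table by `xhiOK`. -/
def xhiTab : List ℕ := [710, 1125, 1420, 1649, 1835, 1993, 2130]
/-- `⌈1024·log(i+2)⌉` from the table `xhiTab` (junk `2130` out of range). -/
def xhi (i : ℕ) : ℕ := xhiTab.getD i 2130
/-- Boolean check of the table `xhiTab` against the log enclosures. -/
def xhiOK (logs : List FI) : Bool := (List.range 7).all fun i => decide ((X8 logs i).hi ≤ (xhi i : ℤ) * 2 ^ 38)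

/-- Symmetric widening of an interval by `d/2^48`. -/
def widen (I : FI) (d : ℤ) : FI := ⟨I.lo - d, I.hi + d⟩

/-- Lipschitz inflation of the point enclosures of `cos/sin(a x_i)` to the cell `[a, a + w/1024]`
(`|cos(u x_i) − cos(a x_i)| ≤ (u − a) x_i ≤ (w/1024)(xhi_i/1024)`): NO further `cosSin` calls. -/
def inflCS (L : List (FI × FI)) (w : ℕ) : List (FI × FI) :=
  (List.range 7).map fun i =>
    (widen (csAt L i).1 ((w : ℤ) * (xhi i : ℤ) * 2 ^ 28), widen (csAt L i).2 ((w : ℤ) * (xhi i : ℤ) * 2 ^ 28))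

/-- One cell `[a, a+h]`, `a = n/1024`, `h = w/1024`, SECOND ORDER: with `q ≤ Q(a)`, `p ≤ Q′(a)` (point
enclosures, 7 `cosSin` calls) and `m ≤ inf_cell Q″` (inflated enclosures), the quadratic minorant
`q + pτ + ½mτ²` is `≥ 0` on `[0, h]` iff it is so at `τ = 0`, at `τ = h`, and — when convex with an
interior critical point — at the vertex (`p² ≤ 2mq`).  All in integers scaled by `2^48`. -/
def cellOK (logs : List FI) (n w : ℕ) : Bool :=
  let L := csList logs (ptFI n)
  let q := (QEnclL L).lo
  let p := (DEnclL logs L).lo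
  let m := (DDEnclL logs (inflCS L w)).lo
  decide (0 ≤ q) && decide (0 ≤ 2 * 1024 ^ 2 * q + 2 * 1024 * p * (w : ℤ) + m * (w : ℤ) ^ 2) &&
    (decide (m ≤ 0) || decide (0 ≤ p) || decide (m * (w : ℤ) ≤ -(1024 * p)) || decide (p * p ≤ 2 * m * q))

/-- Run the cells `[n, n+w₁], [n+w₁, n+w₁+w₂], …` and check they reach `nEnd`. -/
def runCells (logs : List FI) (nEnd : ℕ) : ℕ → List ℕ → Bool
  | n, [] => decide (nEnd ≤ n)
  | n, w :: ws => cellOK logs n w && runCells logs nEnd (n + w) ws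

/-- Zero-order cells for `Q″ ≥ 0` near `0`. -/
def runZero (logs : List FI) (nEnd : ℕ) : ℕ → List ℕ → Bool
  | n, [] => decide (nEnd < n)
  | n, w :: ws => decide (0 ≤ (DDEncl logs (cellFI n w)).lo) && runZero logs nEnd (n + w) ws

/-! ### Soundness of the checker -/

/-- Soundness of `sumEncl`: termwise membership gives membership of the finite sum. -/
theorem mem_sumEncl {f : ℕ → FI} {v : ℕ → ℝ} :
    ∀ n : ℕ, (∀ k, k < n → FI.mem (v k) (f k)) → FI.mem (∑ k ∈ range n, v k) (sumEncl f n)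
  | 0, _ => by simpa [sumEncl] using FI.mem_ofInt 0
  | n + 1, h => by
    rw [Finset.sum_range_succ]
    exact FI.mem_add (mem_sumEncl n fun k hk => h k (by omega)) (h n (by omega))

/-- The `i`-th entry of `csList logs T` is `FI.cosSin (T · X8 logs i)`. -/
theorem csAt_csList (logs : List FI) (T : FI) {i : ℕ} (hi : i < 7) :
    csAt (csList logs T) i = FI.cosSin (T.mul (X8 logs i)) := by
  unfold csAt csList
  rw [List.getD_eq_getElem?_getD, List.getElem?_map, List.getElem?_range hi]
  rfl

variable {logs : List FI}

/-- `x_i = log (i+2) ∈ X8 logs i` for a sound log table. -/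
theorem mem_X8 (hL : ∀ n : ℕ, n ≤ 8 → FI.mem (Real.log n) (RungCert.lg logs n)) {i : ℕ} (hi : i < 7) :
    FI.mem (xN i) (X8 logs i) := by
  unfold xN X8
  exact hL (i + 2) (by omega)

/-- Soundness of the `(cos, sin)(t x_i)` enclosures for `t ∈ T`. -/
theorem mem_cs (hL : ∀ n : ℕ, n ≤ 8 → FI.mem (Real.log n) (RungCert.lg logs n)) {T : FI} {t : ℝ}
    (ht : FI.mem t T) {i : ℕ} (hi : i < 7) :
    FI.mem (Real.cos (t * xN i)) (csAt (csList logs T) i).1 ∧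
      FI.mem (Real.sin (t * xN i)) (csAt (csList logs T) i).2 := by
  rw [csAt_csList logs T hi]
  exact FI.mem_cosSin (FI.mem_mul ht (mem_X8 hL hi))

/-- The values the bilinear enclosures track. -/
noncomputable def QVal (c s : ℕ → ℝ) : ℝ :=
  (yTot : ℝ) - (∑ i ∈ range 7, c i * (rz i : ℝ)) * ((2 : ℤ) : ℝ)
    + ∑ i ∈ range 7, c i * ∑ j ∈ range 7, c j * (yz i j : ℝ)
    + ∑ i ∈ range 7, s i * ∑ j ∈ range 7, s j * (yz i j : ℝ)

/-- Bilinear real form of `Q′` (the value enclosed by `DEnclL`). -/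
noncomputable def DVal (x c s : ℕ → ℝ) : ℝ :=
  (∑ i ∈ range 7, x i * s i * (rz i : ℝ)
    - ∑ i ∈ range 7, x i * s i * ∑ j ∈ range 7, c j * (yz i j : ℝ)
    + ∑ i ∈ range 7, x i * c i * ∑ j ∈ range 7, s j * (yz i j : ℝ)) * ((2 : ℤ) : ℝ)

/-- Bilinear real form of `Q″` (the value enclosed by `DDEnclL`). -/
noncomputable def DDVal (x c s : ℕ → ℝ) : ℝ :=
  (∑ i ∈ range 7, x i * x i * c i * (rz i : ℝ)
    - ∑ i ∈ range 7, x i * x i * c i * ∑ j ∈ range 7, c j * (yz i j : ℝ)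
    - ∑ i ∈ range 7, x i * x i * s i * ∑ j ∈ range 7, s j * (yz i j : ℝ)
    + ∑ i ∈ range 7, x i * c i * ∑ j ∈ range 7, x j * c j * (yz i j : ℝ)
    + ∑ i ∈ range 7, x i * s i * ∑ j ∈ range 7, x j * s j * (yz i j : ℝ)) * ((2 : ℤ) : ℝ)

/-- The integer dual matrix `y8K` is symmetric (kernel `decide`). -/
theorem y8K_symm : ∀ a b : Fin 7, y8K a b = y8K b a := by decide +kernel

/-- `yz` is symmetric. -/
theorem yz_symm (i j : ℕ) : yz i j = yz j i := by
  unfold yz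
  by_cases hi : i < 7
  · by_cases hj : j < 7
    · rw [dif_pos ⟨hi, hj⟩, dif_pos ⟨hj, hi⟩]; exact y8K_symm _ _
    · rw [dif_neg (fun h => hj h.2), dif_neg (fun h => hj h.1)]
  · rw [dif_neg (fun h => hi h.1), dif_neg (fun h => hi h.2)]

/-- The double sum defining `Q` equals its bilinear form `QVal`. -/
theorem Q_bilin (c s : ℕ → ℝ) :
    ∑ i ∈ range 7, ∑ j ∈ range 7, (yz i j : ℝ) * (1 - c i - c j + (c i * c j + s i * s j)) = QVal c s := by
  unfold QVal yTot rz
  simp only [Finset.sum_range_succ, Finset.sum_range_zero, zero_add]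
  rw [yz_symm 1 0, yz_symm 2 0, yz_symm 2 1, yz_symm 3 0, yz_symm 3 1, yz_symm 3 2, yz_symm 4 0, yz_symm 4 1, yz_symm 4 2, yz_symm 4 3, yz_symm 5 0, yz_symm 5 1, yz_symm 5 2, yz_symm 5 3, yz_symm 5 4, yz_symm 6 0, yz_symm 6 1, yz_symm 6 2, yz_symm 6 3, yz_symm 6 4, yz_symm 6 5]
  push_cast
  ring

/-- The double sum defining `Q′` equals its bilinear form `DVal`. -/
theorem D_bilin (x c s : ℕ → ℝ) :
    ∑ i ∈ range 7, ∑ j ∈ range 7, (yz i j : ℝ) * (x i * s i + x j * s j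
      - (x i - x j) * (s i * c j - c i * s j)) = DVal x c s := by
  unfold DVal rz
  simp only [Finset.sum_range_succ, Finset.sum_range_zero, zero_add]
  rw [yz_symm 1 0, yz_symm 2 0, yz_symm 2 1, yz_symm 3 0, yz_symm 3 1, yz_symm 3 2, yz_symm 4 0, yz_symm 4 1, yz_symm 4 2, yz_symm 4 3, yz_symm 5 0, yz_symm 5 1, yz_symm 5 2, yz_symm 5 3, yz_symm 5 4, yz_symm 6 0, yz_symm 6 1, yz_symm 6 2, yz_symm 6 3, yz_symm 6 4, yz_symm 6 5]
  push_cast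
  ring

/-- The double sum defining `Q″` equals its bilinear form `DDVal`. -/
theorem DD_bilin (x c s : ℕ → ℝ) :
    ∑ i ∈ range 7, ∑ j ∈ range 7, (yz i j : ℝ) * (x i ^ 2 * c i + x j ^ 2 * c j
      - (x i - x j) ^ 2 * (c i * c j + s i * s j)) = DDVal x c s := by
  unfold DDVal rz
  simp only [Finset.sum_range_succ, Finset.sum_range_zero, zero_add]
  rw [yz_symm 1 0, yz_symm 2 0, yz_symm 2 1, yz_symm 3 0, yz_symm 3 1, yz_symm 3 2, yz_symm 4 0, yz_symm 4 1, yz_symm 4 2, yz_symm 4 3, yz_symm 5 0, yz_symm 5 1, yz_symm 5 2, yz_symm 5 3, yz_symm 5 4, yz_symm 6 0, yz_symm 6 1, yz_symm 6 2, yz_symm 6 3, yz_symm 6 4, yz_symm 6 5]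
  push_cast
  ring

/-- `Qf t` is `QVal` of the cosine and sine vectors at `t`. -/
theorem Qf_eq (t : ℝ) : Qf t = QVal (fun i => Real.cos (t * xN i)) (fun i => Real.sin (t * xN i)) := by
  rw [← Q_bilin]
  unfold Qf
  refine Finset.sum_congr rfl fun i _ => Finset.sum_congr rfl fun j _ => ?_
  rw [show t * (xN i - xN j) = t * xN i - t * xN j by ring, Real.cos_sub]

/-- `Qd t` is `DVal` of the cosine and sine vectors at `t`. -/
theorem Qd_eq (t : ℝ) : Qd t = DVal xN (fun i => Real.cos (t * xN i)) (fun i => Real.sin (t * xN i)) := by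
  rw [← D_bilin]
  unfold Qd
  refine Finset.sum_congr rfl fun i _ => Finset.sum_congr rfl fun j _ => ?_
  rw [show t * (xN i - xN j) = t * xN i - t * xN j by ring, Real.sin_sub]

/-- `Qdd t` is `DDVal` of the cosine and sine vectors at `t`. -/
theorem Qdd_eq (t : ℝ) : Qdd t = DDVal xN (fun i => Real.cos (t * xN i)) (fun i => Real.sin (t * xN i)) := by
  rw [← DD_bilin]
  unfold Qdd
  refine Finset.sum_congr rfl fun i _ => Finset.sum_congr rfl fun j _ => ?_
  rw [show t * (xN i - xN j) = t * xN i - t * xN j by ring, Real.cos_sub]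

/-- Generic membership for the three bilinear evaluations, given cos/sin enclosures in `L`. -/
theorem mem_QEnclL {L : List (FI × FI)} {c s : ℕ → ℝ} (hc : ∀ i, i < 7 → FI.mem (c i) (csAt L i).1)
    (hs : ∀ i, i < 7 → FI.mem (s i) (csAt L i).2) : FI.mem (QVal c s) (QEnclL L) := by
  unfold QVal QEnclL mvY
  exact FI.mem_add (FI.mem_add (FI.mem_sub (FI.mem_ofInt _)
    (FI.mem_mulInt (mem_sumEncl 7 fun i hi => FI.mem_mulInt (hc i hi) (rz i)) 2))
    (mem_sumEncl 7 fun i hi => FI.mem_mul (hc i hi)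
      (mem_sumEncl 7 fun j hj => FI.mem_mulInt (hc j hj) (yz i j))))
    (mem_sumEncl 7 fun i hi => FI.mem_mul (hs i hi)
      (mem_sumEncl 7 fun j hj => FI.mem_mulInt (hs j hj) (yz i j)))

variable {logs : List FI} in
/-- Soundness of the bilinear interval evaluation `DEnclL` of `Q′`. -/
theorem mem_DEnclL (hL : ∀ n : ℕ, n ≤ 8 → FI.mem (Real.log n) (RungCert.lg logs n)) {L : List (FI × FI)}
    {c s : ℕ → ℝ} (hc : ∀ i, i < 7 → FI.mem (c i) (csAt L i).1)
    (hs : ∀ i, i < 7 → FI.mem (s i) (csAt L i).2) : FI.mem (DVal xN c s) (DEnclL logs L) := by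
  unfold DVal DEnclL mvY
  have hx := fun i (hi : i < 7) => mem_X8 hL hi
  exact FI.mem_mulInt (FI.mem_add (FI.mem_sub
    (mem_sumEncl 7 fun i hi => FI.mem_mulInt (FI.mem_mul (hx i hi) (hs i hi)) (rz i))
    (mem_sumEncl 7 fun i hi => FI.mem_mul (FI.mem_mul (hx i hi) (hs i hi))
      (mem_sumEncl 7 fun j hj => FI.mem_mulInt (hc j hj) (yz i j))))
    (mem_sumEncl 7 fun i hi => FI.mem_mul (FI.mem_mul (hx i hi) (hc i hi))
      (mem_sumEncl 7 fun j hj => FI.mem_mulInt (hs j hj) (yz i j)))) 2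

variable {logs : List FI} in
/-- Soundness of the bilinear interval evaluation `DDEnclL` of `Q″`. -/
theorem mem_DDEnclL (hL : ∀ n : ℕ, n ≤ 8 → FI.mem (Real.log n) (RungCert.lg logs n)) {L : List (FI × FI)}
    {c s : ℕ → ℝ} (hc : ∀ i, i < 7 → FI.mem (c i) (csAt L i).1)
    (hs : ∀ i, i < 7 → FI.mem (s i) (csAt L i).2) : FI.mem (DDVal xN c s) (DDEnclL logs L) := by
  unfold DDVal DDEnclL mvY
  have hx := fun i (hi : i < 7) => mem_X8 hL hi
  exact FI.mem_mulInt (FI.mem_add (FI.mem_add (FI.mem_sub (FI.mem_sub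
    (mem_sumEncl 7 fun i hi =>
      FI.mem_mulInt (FI.mem_mul (FI.mem_mul (hx i hi) (hx i hi)) (hc i hi)) (rz i))
    (mem_sumEncl 7 fun i hi => FI.mem_mul (FI.mem_mul (FI.mem_mul (hx i hi) (hx i hi)) (hc i hi))
      (mem_sumEncl 7 fun j hj => FI.mem_mulInt (hc j hj) (yz i j))))
    (mem_sumEncl 7 fun i hi => FI.mem_mul (FI.mem_mul (FI.mem_mul (hx i hi) (hx i hi)) (hs i hi))
      (mem_sumEncl 7 fun j hj => FI.mem_mulInt (hs j hj) (yz i j))))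
    (mem_sumEncl 7 fun i hi => FI.mem_mul (FI.mem_mul (hx i hi) (hc i hi))
      (mem_sumEncl 7 fun j hj => FI.mem_mulInt (FI.mem_mul (hx j hj) (hc j hj)) (yz i j))))
    (mem_sumEncl 7 fun i hi => FI.mem_mul (FI.mem_mul (hx i hi) (hs i hi))
      (mem_sumEncl 7 fun j hj => FI.mem_mulInt (FI.mem_mul (hx j hj) (hs j hj)) (yz i j)))) 2

/-- The interval scale `SC = 1024 · 2^38` as a real number. -/
theorem SC_eq : (SC : ℝ) = 1024 * 2 ^ 38 := by norm_num [SC]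

/-- `n/1024 ∈ ptFI n`. -/
theorem mem_ptFI (n : ℕ) : FI.mem ((n : ℝ) / 1024) (ptFI n) := by
  have h : ((n : ℝ) / 1024) * SC = (n : ℝ) * 2 ^ 38 := by rw [SC_eq]; ring
  constructor <;> (simp only [ptFI]; push_cast; rw [h]; norm_num)

/-- Every `t ∈ [n/1024, (n+w)/1024]` lies in `cellFI n w`. -/
theorem mem_cellFI (n w : ℕ) {t : ℝ} (h1 : (n : ℝ) / 1024 ≤ t) (h2 : t ≤ (n : ℝ) / 1024 + (w : ℝ) / 1024) :
    FI.mem t (cellFI n w) := by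
  have hS : (SC : ℝ) = 1024 * 2 ^ 38 := SC_eq
  constructor
  · simp only [cellFI]; push_cast; rw [hS]; nlinarith
  · simp only [cellFI]; push_cast; rw [hS]; nlinarith

/-- Soundness of `QEncl`: `Q t ∈ QEncl logs T` for `t ∈ T`. -/
theorem mem_QEncl (hL : ∀ n : ℕ, n ≤ 8 → FI.mem (Real.log n) (RungCert.lg logs n)) {T : FI} {t : ℝ}
    (ht : FI.mem t T) : FI.mem (Qf t) (QEncl logs T) := by
  rw [Qf_eq]
  exact mem_QEnclL (fun i hi => (mem_cs hL ht hi).1) (fun i hi => (mem_cs hL ht hi).2)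

/-- Soundness of `DEncl`: `Q′ t ∈ DEncl logs T` for `t ∈ T`. -/
theorem mem_DEncl (hL : ∀ n : ℕ, n ≤ 8 → FI.mem (Real.log n) (RungCert.lg logs n)) {T : FI} {t : ℝ}
    (ht : FI.mem t T) : FI.mem (Qd t) (DEncl logs T) := by
  rw [Qd_eq]
  exact mem_DEnclL hL (fun i hi => (mem_cs hL ht hi).1) (fun i hi => (mem_cs hL ht hi).2)

/-- Soundness of `DDEncl`: `Q″ t ∈ DDEncl logs T` for `t ∈ T`. -/
theorem mem_DDEncl (hL : ∀ n : ℕ, n ≤ 8 → FI.mem (Real.log n) (RungCert.lg logs n)) {T : FI} {t : ℝ}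
    (ht : FI.mem t T) : FI.mem (Qdd t) (DDEncl logs T) := by
  rw [Qdd_eq]
  exact mem_DDEnclL hL (fun i hi => (mem_cs hL ht hi).1) (fun i hi => (mem_cs hL ht hi).2)

/-- `0 ≤ x_i = log (i+2)`. -/
theorem xN_nonneg (i : ℕ) : 0 ≤ xN i := Real.log_nonneg (by norm_cast; omega)

/-- `x_i ≤ xhi i / 1024` when the table check `xhiOK` passes. -/
theorem xN_le (hL : ∀ n : ℕ, n ≤ 8 → FI.mem (Real.log n) (RungCert.lg logs n)) (hx : xhiOK logs = true)
    {i : ℕ} (hi : i < 7) : xN i ≤ (xhi i : ℝ) / 1024 := by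
  have h1 := (mem_X8 hL hi).2
  have h2 : (X8 logs i).hi ≤ (xhi i : ℤ) * 2 ^ 38 :=
    of_decide_eq_true (List.all_eq_true.1 hx i (List.mem_range.2 hi))
  have h3 : ((X8 logs i).hi : ℝ) ≤ (xhi i : ℝ) * 2 ^ 38 := by exact_mod_cast h2
  rw [le_div_iff₀ (by norm_num : (0 : ℝ) < 1024)]
  have hS : (SC : ℝ) = 1024 * 2 ^ 38 := by norm_num [SC]
  have h4 : xN i * SC ≤ (xhi i : ℝ) * 2 ^ 38 := le_trans h1 h3
  rw [hS] at h4
  nlinarith [h4]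

/-- A point within `d/2^48` of a member of `I` lies in `widen I d`. -/
theorem mem_widen {x y : ℝ} {I : FI} {d : ℤ} (h : FI.mem x I) (hd : |y - x| * SC ≤ (d : ℝ)) :
    FI.mem y (widen I d) := by
  have hA : |(y - x) * SC| ≤ d := by rwa [abs_mul, abs_of_pos SC_pos]
  obtain ⟨hA1, hA2⟩ := abs_le.1 hA
  obtain ⟨h1, h2⟩ := h
  constructor
  · simp only [widen]; push_cast; nlinarith
  · simp only [widen]; push_cast; nlinarith

/-- Entries of the inflated `(cos, sin)` list `inflCS L w`. -/
theorem csAt_inflCS (L : List (FI × FI)) (w : ℕ) {i : ℕ} (hi : i < 7) :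
    csAt (inflCS L w) i = (widen (csAt L i).1 ((w : ℤ) * (xhi i : ℤ) * 2 ^ 28),
      widen (csAt L i).2 ((w : ℤ) * (xhi i : ℤ) * 2 ^ 28)) := by
  unfold inflCS
  rw [csAt, List.getD_eq_getElem?_getD, List.getElem?_map, List.getElem?_range hi]
  rfl

/-- Soundness of cell inflation: `(cos, sin)(u x_i)` for `u` in the cell `[n/1024, (n+w)/1024]`
lies in the point enclosures at `n/1024` widened by `w · xhi i · 2^28`. -/
theorem mem_inflCS (hL : ∀ n : ℕ, n ≤ 8 → FI.mem (Real.log n) (RungCert.lg logs n)) (hx : xhiOK logs = true)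
    (n w : ℕ) {u : ℝ} (hu1 : (n : ℝ) / 1024 ≤ u) (hu2 : u ≤ (n : ℝ) / 1024 + (w : ℝ) / 1024)
    {i : ℕ} (hi : i < 7) :
    FI.mem (Real.cos (u * xN i)) (csAt (inflCS (csList logs (ptFI n)) w) i).1 ∧
      FI.mem (Real.sin (u * xN i)) (csAt (inflCS (csList logs (ptFI n)) w) i).2 := by
  rw [csAt_inflCS _ w hi]
  obtain ⟨hc, hs⟩ := mem_cs hL (mem_ptFI n) hi
  have hxle := xN_le hL hx hi
  have hx0 := xN_nonneg i
  have hS : (SC : ℝ) = 1024 * 1024 * 2 ^ 28 := by norm_num [SC]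
  have harg : |u * xN i - (n : ℝ) / 1024 * xN i| * SC ≤ (((w : ℤ) * (xhi i : ℤ) * 2 ^ 28 : ℤ) : ℝ) := by
    rw [← sub_mul, abs_mul, abs_of_nonneg hx0, abs_of_nonneg (by linarith)]
    push_cast
    rw [hS]
    have h1 : (u - (n : ℝ) / 1024) * xN i ≤ ((w : ℝ) / 1024) * ((xhi i : ℝ) / 1024) :=
      mul_le_mul (by linarith) hxle hx0 (by positivity)
    nlinarith [h1]
  exact ⟨mem_widen hc (le_trans (mul_le_mul_of_nonneg_right (Real.abs_cos_sub_cos_le _ _) SC_pos.le) harg),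
    mem_widen hs (le_trans (mul_le_mul_of_nonneg_right (Real.abs_sin_sub_sin_le _ _) SC_pos.le) harg)⟩


end Batch3F

end Summit.RiemannHypothesis.RiemannHypothesis.Theorems.IntegerScrew.Manifest
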